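import Mathlib
import HarnessLib
import Summits.HubbardSuperconductivity.HubbardSuperconductivity.Theorems.ComplexGFFStiffnessHolomorphicFreeHtEngines
import Summits.HubbardSuperconductivity.HubbardSuperconductivity.Theorems.ComplexGFFStiffnessFreeHtKernelPair
import Literature.MathematicalPhysics.StatisticalMechanics.AbkmPackageNextHTwoKernel

/-!
# Crux child `TwoKernelSkBound` (stmt-HubbardSuperconductivity-27414), line `banach_two_kernel`, stub `stub_f4l2ShrinkLoc` —
# block B2 (kernel pair × intermediate-Hamiltonian shift) of the second-order two-kernel slot, `N`-free

Route `route-HubbardSuperconductivity-ComplexGFFStiffness`; memo `Cruxes/HypACumulant/TWOKERNEL-PLAN-27414-v3.md` §0/§2 (R3).  With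
`G_ρ(H̃) = nextK D_ρ.s π (stepMeasure D_ρ.𝒞) (e^{−toHam u}) (e^{−H̃}) (mulExt v)`, `D_ρ = abkmStepData P.L P.R k (Q.kernels ρ)` and
`H̃_ρ = nextH D_ρ (toHam u) (mulExt v)`, block B2 of the four-corner split of `S_{q+y+z} − S_{q+y} − S_{q+z} + S_q` is
`[G_{q+y+z}(H̃_{q+y}) − G_{q+y}(H̃_{q+y})] − [G_{q+y+z}(H̃_q) − G_{q+y}(H̃_q)]`: the kernel pair `(q+y+z, q+y)` (sides differ by `z`)
evaluated at two intermediate Hamiltonians differing by `δ_y = H̃_{q+y} − H̃_q` (`‖δ_y‖ ≤ ℓ_H|y|₁ max(‖u‖,c_v)`, p827565).  By the pair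
engine `weakNormLE_sub_nextK_freeHt_pair_package` (p833074) along the complex line `H̃_q + σδ_y` with radius `ρ₀/(4‖δ_y‖)` and the
uniform kernel-pair bound `l₂|z|₁max(‖u‖,c_v)` of `exists_weakNormLE_nextK_freeHt_kernel_sub` (U2, p832948) on that disc:
**for every package with `0 < P.r` there are `N`-free `l ≥ 0`, `T₂ > 0` with `‖B2‖_{k+1} ≤ l·|y|₁|z|₁·max(‖u‖, c_v)`** for all corners in
the ball with `|y|₁, |z|₁ ≤ T₂` and states in the `P.r`-ball (`exists_weakNormLE_blockB2`).  Block B3 is the same statement with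
`(y, z)` exchanged.  All proved, no `sorry`.  Honest scope: rung route (stiffness of a complex Gaussian gradient field via the
[ABKM19] RG); nothing about superconductivity in the Hubbard model.

## References
* S. Adams, S. Buchholz, R. Kotecký, S. Müller, arXiv:1910.13564, Definition 6.5 (6.34), Theorem 6.8, Lemma 12.6 (12.53)
  [AdamsBuchholzKoteckyMuller2019].
-/

noncomputable section

-- `Summit.<Summit>.<Problem>`: single-conjunct summit, the duplicate component is mandated (D-0017).
set_option linter.dupNamespace false

namespace Summit.HubbardSuperconductivity.HubbardSuperconductivity.Theorems.ComplexGFF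

open MeasureTheory Metric Set
open scoped BigOperators
open Literature.MathematicalPhysics.StatisticalMechanics.GradientRG
open Literature.MathematicalPhysics.StatisticalMechanics.TorusPolymer (IsPolymer blockOf reblock)
open Literature.Barriers.CriticalPhenomena.LongRangePhi4.Polymer (IsConn)
open Literature.MathematicalPhysics.StatisticalMechanics

variable {d : ℕ}

/-- `esum ((q + y + z) − (q + y)) = esum z` and `esum ((q + y) − q) = esum y` (bookkeeping). -/
theorem esum_corner_sides (q y z : Matrix (Fin d) (Fin d) ℝ) :
    esum (q + y + z - (q + y)) = esum z ∧ esum (q + y - q) = esum y := by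
  constructor
  · rw [add_sub_cancel_left]
  · rw [add_sub_cancel_left]

set_option maxHeartbeats 1600000 in
/-- **Block B2, `N`-free** (module docstring). [cite: AdamsBuchholzKoteckyMuller2019, Lemma 12.6 (12.53) / Definition 6.5 (6.34)] -/
theorem exists_weakNormLE_blockB2 (P : PackageData d) [Fact (0 < P.h)] [Fact (0 < P.L)] (hr0 : 0 < P.r) :
    ∃ l T₂ : ℝ, 0 ≤ l ∧ 0 < T₂ ∧ ∀ (N M : ℕ) [NeZero M] (Q : PackageAt P N M),
      ∀ q y z : Matrix (Fin d) (Fin d) ℝ, P.InBall q → P.InBall (q + y) → P.InBall (q + y + z) →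
      esum y ≤ T₂ → esum z ≤ T₂ → ∀ k, k + 1 ≤ N →
      ∀ (u : HamSpace ℂ d (fieldWt P.h (P.L : ℝ) d k) ((P.L : ℝ) ^ k) (P.L ^ (d * k)))
        (v : activitySpace Q.normParams k) (cv : ℝ), ‖u‖ ≤ P.r →
        activityNormLE Q.normParams k v cv → cv ≤ P.r →
      WeakNormLE Q.normParams (k + 1)
        (fun X ψ =>
          (nextK (abkmStepData P.L P.R k (Q.kernels (q + y + z))).s
              (reblock (abkmStepData P.L P.R k (Q.kernels (q + y + z))).s
                ((abkmStepData P.L P.R k (Q.kernels (q + y + z))).L * (abkmStepData P.L P.R k (Q.kernels (q + y + z))).s))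
              (stepMeasure (abkmStepData P.L P.R k (Q.kernels (q + y + z))).𝒞) (expNegH (HamSpace.toHam u))
              (expNegH (nextH (abkmStepData P.L P.R k (Q.kernels (q + y))) (HamSpace.toHam u)
                (mulExt ((v : activitySpace Q.normParams k) : Finset (Fin d → ZMod M) → ((Fin d → ZMod M) → ℝ) → ℂ))))
              (mulExt ((v : activitySpace Q.normParams k) : Finset (Fin d → ZMod M) → ((Fin d → ZMod M) → ℝ) → ℂ)) X ψ -
            nextK (abkmStepData P.L P.R k (Q.kernels (q + y))).s
              (reblock (abkmStepData P.L P.R k (Q.kernels (q + y))).s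
                ((abkmStepData P.L P.R k (Q.kernels (q + y))).L * (abkmStepData P.L P.R k (Q.kernels (q + y))).s))
              (stepMeasure (abkmStepData P.L P.R k (Q.kernels (q + y))).𝒞) (expNegH (HamSpace.toHam u))
              (expNegH (nextH (abkmStepData P.L P.R k (Q.kernels (q + y))) (HamSpace.toHam u)
                (mulExt ((v : activitySpace Q.normParams k) : Finset (Fin d → ZMod M) → ((Fin d → ZMod M) → ℝ) → ℂ))))
              (mulExt ((v : activitySpace Q.normParams k) : Finset (Fin d → ZMod M) → ((Fin d → ZMod M) → ℝ) → ℂ)) X ψ) -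
          (nextK (abkmStepData P.L P.R k (Q.kernels (q + y + z))).s
              (reblock (abkmStepData P.L P.R k (Q.kernels (q + y + z))).s
                ((abkmStepData P.L P.R k (Q.kernels (q + y + z))).L * (abkmStepData P.L P.R k (Q.kernels (q + y + z))).s))
              (stepMeasure (abkmStepData P.L P.R k (Q.kernels (q + y + z))).𝒞) (expNegH (HamSpace.toHam u))
              (expNegH (nextH (abkmStepData P.L P.R k (Q.kernels q)) (HamSpace.toHam u)
                (mulExt ((v : activitySpace Q.normParams k) : Finset (Fin d → ZMod M) → ((Fin d → ZMod M) → ℝ) → ℂ))))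
              (mulExt ((v : activitySpace Q.normParams k) : Finset (Fin d → ZMod M) → ((Fin d → ZMod M) → ℝ) → ℂ)) X ψ -
            nextK (abkmStepData P.L P.R k (Q.kernels (q + y))).s
              (reblock (abkmStepData P.L P.R k (Q.kernels (q + y))).s
                ((abkmStepData P.L P.R k (Q.kernels (q + y))).L * (abkmStepData P.L P.R k (Q.kernels (q + y))).s))
              (stepMeasure (abkmStepData P.L P.R k (Q.kernels (q + y))).𝒞) (expNegH (HamSpace.toHam u))
              (expNegH (nextH (abkmStepData P.L P.R k (Q.kernels q)) (HamSpace.toHam u)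
                (mulExt ((v : activitySpace Q.normParams k) : Finset (Fin d → ZMod M) → ((Fin d → ZMod M) → ℝ) → ℂ))))
              (mulExt ((v : activitySpace Q.normParams k) : Finset (Fin d → ZMod M) → ((Fin d → ZMod M) → ℝ) → ℂ)) X ψ))
        (l * esum y * esum z * max ‖u‖ cv) := by
  obtain ⟨l₂, ρ₀, T₁, hl₂, hρ₀, hT₁, hU2⟩ := exists_weakNormLE_nextK_freeHt_kernel_sub P hr0
  obtain ⟨ℓH, hℓH0, hnextH⟩ := P.exists_hamNorm_nextH_sub
  -- the threshold: `ℓ_H T₂ r ≤ ρ₀/8`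
  set T₂ : ℝ := min T₁ (ρ₀ / (8 * (ℓH + 1) * (P.r + 1))) with hT₂def
  have hT₂0 : 0 < T₂ := lt_min hT₁ (by positivity)
  have hT₂1 : T₂ ≤ T₁ := min_le_left _ _
  have hT₂ρ : ℓH * T₂ * P.r ≤ ρ₀ / 8 := by
    have h1 : T₂ ≤ ρ₀ / (8 * (ℓH + 1) * (P.r + 1)) := min_le_right _ _
    have h2 : ℓH * T₂ * P.r ≤ (ℓH + 1) * (ρ₀ / (8 * (ℓH + 1) * (P.r + 1))) * (P.r + 1) := by
      have := mul_le_mul (mul_le_mul (by linarith : ℓH ≤ ℓH + 1) h1 hT₂0.le (by linarith))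
        (by linarith : P.r ≤ P.r + 1) P.hr0 (by positivity)
      exact this
    have h3 : (ℓH + 1) * (ρ₀ / (8 * (ℓH + 1) * (P.r + 1))) * (P.r + 1) = ρ₀ / 8 := by
      field_simp
    linarith [h2, h3.le]
  set l : ℝ := ((P.r₀ : ℝ) + 1) * 8 * l₂ * ℓH * P.r / ρ₀ with hldef
  have hl0 : 0 ≤ l := by rw [hldef]; have := P.hr0; positivity
  refine ⟨l, T₂, hl0, hT₂0, fun N M _ Q => ?_⟩
  intro q y z hq hqy hqyz hy hz k hk u v cv hu hv hcv
  -- sizes and the state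
  have hPA : 0 < Q.normParams.A := P.A_pos
  have hL0r : (0 : ℝ) < P.L := by exact_mod_cast P.hLodd.pos
  have h𝔥 : 0 < fieldWt P.h (P.L : ℝ) d k := fieldWt_pos P.hh hL0r d k
  have hRk : (0 : ℝ) < (P.L : ℝ) ^ k := pow_pos hL0r k
  have hnpos : 0 < P.L ^ (d * k) := pow_pos P.hLodd.pos _
  have hnn : ∀ G : RelevantHamiltonian ℂ d, 0 ≤ hamNorm (fieldWt P.h (P.L : ℝ) d k) ((P.L : ℝ) ^ k) (P.L ^ (d * k)) G :=
    fun G => hamNorm_nonneg h𝔥.le hRk.le _ _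
  have hMt : M = Q.normParams.L ^ k * P.L ^ (N - k) := by
    show M = P.L ^ k * P.L ^ (N - k)
    rw [Q.hM, ← pow_add, Nat.add_sub_cancel' (by omega)]
  have hcv0 : 0 ≤ cv := nonneg_of_weakNormLE hPA hMt P.hLodd.pow P.hLodd.pow hv
  set mx := max ‖u‖ cv with hmxdef
  have hmx0 : 0 ≤ mx := le_max_of_le_left (norm_nonneg _)
  have hmxr : mx ≤ P.r := max_le hu hcv
  have hy0 : 0 ≤ esum y := entrySum_nonneg _
  have hz0 : 0 ≤ esum z := entrySum_nonneg _
  set H := HamSpace.toHam u with hHdef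
  set Kf := mulExt ((v : activitySpace Q.normParams k) :
    Finset (Fin d → ZMod M) → ((Fin d → ZMod M) → ℝ) → ℂ) with hKfdef
  have hnormu : hamNorm (fieldWt P.h (P.L : ℝ) d k) ((P.L : ℝ) ^ k) (P.L ^ (d * k)) H = ‖u‖ := by
    rw [hHdef, HamSpace.norm_def]
  have hH8 : hamNorm (fieldWt P.h (P.L : ℝ) d k) ((P.L : ℝ) ^ k) (P.L ^ (d * k)) H ≤ 1 / 8 := by
    rw [hnormu]; exact hu.trans (P.hr.trans (by norm_num))
  have hva : WeakNormLE Q.normParams k ((v : activitySpace Q.normParams k) :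
      Finset (Fin d → ZMod M) → ((Fin d → ZMod M) → ℝ) → ℂ) cv := hv
  set D00 := abkmStepData P.L P.R k (Q.kernels q) with hD00
  set D10 := abkmStepData P.L P.R k (Q.kernels (q + y)) with hD10
  set D11 := abkmStepData P.L P.R k (Q.kernels (q + y + z)) with hD11
  set Ht0 := nextH D00 H Kf with hHt0
  set Ht1 := nextH D10 H Kf with hHt1
  set δy := Ht1 - Ht0 with hδydef
  set nδ := hamNorm (fieldWt P.h (P.L : ℝ) d k) ((P.L : ℝ) ^ k) (P.L ^ (d * k)) δy with hnδdef
  have hnδ0 : 0 ≤ nδ := hnn _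
  -- `‖δ_y‖ ≤ ℓ_H |y|₁ mx ≤ ρ₀/8`, `‖H̃_{q+y+z} − H̃_{q+y}‖ ≤ ℓ_H |z|₁ mx ≤ ρ₀/8`
  have hδy : nδ ≤ ℓH * esum y * mx := by
    have h := hnextH N M Q q (q + y) hq hqy k hk u v cv hv
    rw [(esum_corner_sides q y z).2] at h
    exact h
  have hδz : hamNorm (fieldWt P.h (P.L : ℝ) d k) ((P.L : ℝ) ^ k) (P.L ^ (d * k)) (nextH D11 H Kf - Ht1) ≤ ℓH * esum z * mx := by
    have h := hnextH N M Q (q + y) (q + y + z) hqy hqyz k hk u v cv hv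
    rw [(esum_corner_sides q y z).1] at h
    exact h
  have hymx : ℓH * esum y * mx ≤ ρ₀ / 8 :=
    le_trans (mul_le_mul (mul_le_mul_of_nonneg_left hy hℓH0) hmxr hmx0 (by positivity)) hT₂ρ
  have hzmx : ℓH * esum z * mx ≤ ρ₀ / 8 :=
    le_trans (mul_le_mul (mul_le_mul_of_nonneg_left hz hℓH0) hmxr hmx0 (by positivity)) hT₂ρ
  have hnδρ : nδ ≤ ρ₀ / 8 := hδy.trans hymx
  -- the target size is nonnegative
  have hrhs0 : 0 ≤ l * esum y * esum z * mx := by positivity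
  by_cases hδ0 : nδ = 0
  · -- `δ_y = 0`: the two brackets coincide
    have hδ : δy = 0 := eq_zero_of_hamNorm_eq_zero h𝔥 hRk hnpos hδ0
    have hHt : Ht1 = Ht0 := sub_eq_zero.1 hδ
    intro X hX hXc φ
    simp only [hHt, sub_self]
    rw [tayNorm_const, norm_zero]
    exact mul_nonneg (mul_nonneg hrhs0 (WeakNormLE.aFactor_pos hPA (k + 1) X).le)
      ((Q.normParams.W.weight_pos (k + 1) X φ).le)
  -- `δ_y ≠ 0`: the pair engine along `H̃_q + σ δ_y` with radius `R = ρ₀ / (4‖δ_y‖)`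
  have hnδpos : 0 < nδ := lt_of_le_of_ne hnδ0 (Ne.symm hδ0)
  set R : ℝ := ρ₀ / (4 * nδ) with hRdef
  have hR0 : 0 < R := by positivity
  have hRnδ : R * nδ = ρ₀ / 4 := by rw [hRdef]; field_simp
  have hR1 : (1 : ℂ) ∈ ball (0 : ℂ) R := by
    rw [mem_ball_zero_iff, norm_one, hRdef, lt_div_iff₀ (by positivity)]
    linarith [hnδρ]
  -- the uniform kernel-pair bound on the disc (U2)
  have hG : ∀ σ ∈ ball (0 : ℂ) R, WeakNormLE Q.normParams (k + 1)
      (fun X ψ => nextK D11.s (reblock D11.s (D11.L * D11.s)) (stepMeasure D11.𝒞) (expNegH H) (expNegH (Ht0 + σ • δy)) Kf X ψ -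
        nextK D10.s (reblock D10.s (D10.L * D10.s)) (stepMeasure D10.𝒞) (expNegH H) (expNegH (Ht0 + σ • δy)) Kf X ψ)
      (l₂ * esum (q + y + z - (q + y)) * mx) := by
    intro σ hσ
    have hσ' : ‖σ‖ ≤ R := le_of_lt (mem_ball_zero_iff.1 hσ)
    refine hU2 N M Q (q + y + z) (q + y) hqyz hqy ?_ k hk u v cv hu hv hcv (Ht0 + σ • δy) ?_
    · rw [(esum_corner_sides q y z).1]; exact hz.trans hT₂1
    · -- `‖H̃_q + σδ_y − H̃_{q+y+z}‖ ≤ ‖δ_y‖ + ‖H̃_{q+y+z} − H̃_{q+y}‖ + |σ|‖δ_y‖ ≤ ρ₀`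
      have e : Ht0 + σ • δy - nextH D11 H Kf = (-δy) + (-(nextH D11 H Kf - Ht1)) + σ • δy := by
        rw [hδydef]; abel
      rw [e]
      have h1 := hamNorm_add_le h𝔥.le hRk.le (P.L ^ (d * k)) ((-δy) + (-(nextH D11 H Kf - Ht1))) (σ • δy)
      have h2 := hamNorm_add_le h𝔥.le hRk.le (P.L ^ (d * k)) (-δy) (-(nextH D11 H Kf - Ht1))
      rw [hamNorm_neg, hamNorm_neg] at h2
      rw [hamNorm_complex_smul] at h1
      have h3 : ‖σ‖ * nδ ≤ ρ₀ / 4 := by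
        calc ‖σ‖ * nδ ≤ R * nδ := mul_le_mul_of_nonneg_right hσ' hnδ0
          _ = ρ₀ / 4 := hRnδ
      linarith [h1, h2, h3, hnδρ, hδz, hzmx]
  -- the pair engine
  have hE := weakNormLE_sub_nextK_freeHt_pair_package P Q (q := q + y) (q' := q + y + z) hqy hqyz hk hH8 hcv0 hva
    (fun Y => activitySpace.contDiff v Y) (fun Y hY hYc => activitySpace.isGaugeLocal v hY hYc) Ht0 δy hG hR1
  -- identify the corners and bound the constant
  have e1 : Ht0 + (1 : ℂ) • δy = Ht1 := by rw [one_smul, hδydef]; abel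
  have e0 : Ht0 + (0 : ℂ) • δy = Ht0 := by rw [zero_smul, add_zero]
  rw [e1, e0] at hE
  refine hE.mono hPA ?_
  rw [(esum_corner_sides q y z).1, norm_one, mul_one]
  -- `(r₀+1)·(2 l₂|z|mx / R) = (r₀+1)·8 l₂ |z| mx ‖δ_y‖/ρ₀ ≤ l |y||z| mx`
  have hRinv : 2 * (l₂ * esum z * mx) / R = 8 * l₂ * esum z * mx * nδ / ρ₀ := by
    rw [hRdef]; field_simp; ring
  rw [hRinv]
  have hkey : ((P.r₀ : ℝ) + 1) * (8 * l₂ * esum z * mx * nδ / ρ₀) ≤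
      ((P.r₀ : ℝ) + 1) * (8 * l₂ * esum z * mx * (ℓH * esum y * P.r) / ρ₀) := by
    have h1 : nδ ≤ ℓH * esum y * P.r := hδy.trans (mul_le_mul_of_nonneg_left hmxr (by positivity))
    have h2 : 8 * l₂ * esum z * mx * nδ ≤ 8 * l₂ * esum z * mx * (ℓH * esum y * P.r) :=
      mul_le_mul_of_nonneg_left h1 (by positivity)
    exact mul_le_mul_of_nonneg_left (div_le_div_of_nonneg_right h2 hρ₀.le) (by positivity)
  refine hkey.trans (le_of_eq ?_)
  rw [hldef]
  field_simp

end Summit.HubbardSuperconductivity.HubbardSuperconductivity.Theorems.ComplexGFF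

end
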